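import Summits.QuantumFields.YangMills.Theorems.BalabanUVNodesN15KingModelBlockFieldMeasureContinuumLimit
import Summits.QuantumFields.YangMills.Theorems.BalabanUVNodesN15KingModelFreeRGDatum

/-!
# BalabanUVNodes ∕ N15 — THE KING-MODEL RUNG (PART Ϡ-l): THE CONTINUUM LIMIT OF THE FREE FIELD's EFFECTIVE ACTIONS, BY NAME ON THE RUNG's `RGData` DATUM —
# `S^{(k),1}(φ) = ½⟨φ, Δ^{(k)}φ⟩ + ln 𝒩(Δ^{(k)}) → S^{(∞),1}(φ) := ½⟨φ, Δ^{(∞)}φ⟩ + ln 𝒩(Δ^{(∞)})` FOR EVERY DEPTH `m` AND EVERY UNIT-LATTICE FIELD `φ`, WITH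
# `Δ^{(∞)}` IN CLOSED FORM AND `∫ e^{−S^{(∞),1}} = 1`
# (Track A, DAG node N15 = NE2; FAN-OUT v1.1 §N15 s3 «KING-MODEL RUNG … NE2's analogue DECIDED in the model»)

HONEST FRAMING.  Count-neutral (cell `pub-ymgap`, seat `pub-ymgap-dag-n15-e` g32; `--supports stmt-QuantumFields-27366 --as helper` = K3⁸
`SpineGivenEndpointR13SepCoPHV`).  TEMPLATE LITERATURE: C. King, *The U(1) Higgs model. I. The continuum limit*, Commun. Math. Phys. **102** (1986) 649–677
[King1986] — KING's OWN `A = 0` FREE MODEL: the effective actions `S^{(k),1}` of (3.14) p. 657 at zero coupling, `S^{(k),1}(φ) = ½⟨φ,Δ^{(k)}φ⟩ + ln𝒩(Δ^{(k)})`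
(the rung's part Τ-e datum `FreeField.kingFreeRG` ∕ `kingFreeS` on the typer's schema `King1986.ContinuumLimit.RGData`, seat g19), Theorem 3.4 (3.9) p. 656
«|S^{(k),1} from ε_K − S^{(k),1} from ε_{K+n}| ≦ CL^{−γk}|T|» and p. 657 «Hence … is a Cauchy sequence», and the continuum action identified by parts Ϡ-g∕Ϡ-k
(`effLaplacianLim`, `tendsto_gaussNorm_effLaplacian`).  NOT the interacting model; NOT Bałaban's objects; NOT a node discharge (N15 is booked through n15-a's knit,
untouched here); nothing continuum-Yang–Mills ∕ ℝ⁴ ∕ OS ∕ mass-gap ∕ Clay.  0 `sorry`; standard axioms; 0 `def`.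

THE MATHEMATICS.  At depth `m` (unit lattice `T₁ = Π ℤ∕(M₀L^m)`, unit mass² `m²ε_m²`) the datum's `S m (k+1)` is `½⟨φ, Δ^{(k+1)}φ⟩ + ln𝒩(Δ^{(k+1)})` with `Δ^{(k+1)} =
effLaplacian (L^{k+1}) T₁ a_{k+1} L^{2(k+1)} (m²ε_m²)` — EXACTLY the sequence of parts Ϡ-g∕Ϡ-k.  Their `tendsto_quadForm_effLaplacian` and `tendsto_gaussNorm_effLaplacian`
(dominated convergence with the uniform coercivity `δ_∞`) give, with the continuity of `ln` at the positive limit `𝒩(Δ^{(∞)}) > 0`, the pointwise limit of the effective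
actions (§1); the limit action is normalised, `∫e^{−S^{(∞),1}(φ)}dφ = 1` (§2), as every `S^{(k),1}` is (part Τ-a: `Z^{ε_K} ≡ 1`) — Thm 2.1 (i)'s trivial free-field
limit `Z = 1` now sits UNDER an identified limit of the actions themselves.

WHAT THIS FILE PROVES (kernel).  §1 `kingFreeOp_succ` (the datum's operator IS the rung's `effLaplacian` sequence, `rfl`), `unitMassSq_pos`, ★★★ **`tendsto_kingFreeS`**
(`kingFreeS L M₀ a m² m k φ → ½⟨φ,Δ^{(∞)}φ⟩ + ln𝒩(Δ^{(∞)})`, odd `L ≥ 2`, `a, m² > 0`, cubes of dimension `d + 1`), ★★★ **`tendsto_kingFreeRG_S`** (the same BY NAME on the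
`RGData` datum's field `S`).  §2 ★★ **`integral_exp_neg_kingFreeS_lim`** (`∫e^{−S^{(∞),1}} = 1`), `tendsto_exp_neg_kingFreeS` (the densities `e^{−S^{(k),1}(φ)}` converge pointwise).

HONEST SCOPE.  The FREE model (`g = 0`), unit-lattice objects at fixed depth `m`; cubic tori of dimension `d + 1 ≥ 1`, odd `L ≥ 2`; the fine-lattice sources `h` of
Thm 2.1 are represented by unit-lattice sources only in part Ϡ-k.  N15 untouched; counts unmoved.  Locators: [King1986] (2.4)–(2.6) p.652, (2.13)–(2.16) p.653,
Thm 2.1 (2.22) p.654, Thm 3.4 (3.9) p.656, (3.14) p.657, (3.89)–(3.93) pp.668–669.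
-/

noncomputable section

open scoped BigOperators
open Finset Matrix Filter Topology MeasureTheory

namespace Summit.QuantumFields.YangMills.BalabanUVNodes.N15KingModelRung

open Literature.MathematicalPhysics.QuantumFieldTheory.Balaban1983to89.B5Prop11Plancherel (Tor)
open Literature.MathematicalPhysics.QuantumFieldTheory.King1986 (aK aK_pos)
open Literature.MathematicalPhysics.QuantumFieldTheory.King1986.Torus
open Literature.MathematicalPhysics.QuantumFieldTheory.King1986.ContinuumLimit (eps eps_pos RGData)
open Summit.QuantumFields.YangMills.BalabanUVNodes.N15KingModelRung.FreeField (gaussNorm gaussNorm_pos cubeSide unitMassSq kingFreeOp kingFreeS kingFreeRG)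

variable {d : ℕ}

section Action

variable (L : ℕ) [NeZero L] (M₀ : ℕ) [NeZero M₀]

/-! ## §1 The effective actions converge -/

/-- The datum's operator at step `k + 1` IS the rung's effective Laplacian at level `k + 1` on the depth-`m` unit torus (`rfl`). [cite: King1986, (2.14) p.653, (3.15) p.657] -/
theorem kingFreeOp_succ (a msq : ℝ) (m k : ℕ) :
    kingFreeOp (d := d + 1) L M₀ a msq m (k + 1)
      = effLaplacian (L ^ (k + 1)) (cubeSide (d := d + 1) M₀ L m) (aK a L (k + 1)) (((L ^ (k + 1) : ℕ) : ℝ) ^ 2) (unitMassSq msq L m) := rfl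

omit [NeZero L] [NeZero M₀] in
/-- The unit-lattice mass² is positive (`m² > 0`, `L ≥ 1`). [cite: King1986, (4.4) p.670] -/
theorem unitMassSq_pos {msq : ℝ} (hmsq : 0 < msq) (hL : 0 < L) (m : ℕ) : 0 < unitMassSq msq L m := by
  unfold unitMassSq
  have := eps_pos hL m
  positivity

/-- ★★★ **THE FREE EFFECTIVE ACTIONS CONVERGE TO KING's CONTINUUM ACTION, IN CLOSED FORM**: for `L` odd `≥ 2`, `a, m² > 0`, every depth `m` and every unit-lattice
field `φ` on the cube `Π_{μ ≤ d} ℤ∕(M₀L^m)`, `S^{(k),1}(φ) = kingFreeS L M₀ a m² m k φ → ½⟨φ, Δ^{(∞)}φ⟩ + ln 𝒩(Δ^{(∞)})` as `k → ∞`, `Δ^{(∞)} = effLaplacianLim L T₁ a (m²ε_m²)`.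
[cite: King1986, Thm 3.4 (3.9) p.656, (3.14) p.657, (3.89)–(3.93) pp.668–669, (2.14) p.653] -/
theorem tendsto_kingFreeS (hLodd : Odd L) (hL : 2 ≤ L) {a msq : ℝ} (ha : 0 < a) (hmsq : 0 < msq) (m : ℕ) (φ : Tor (cubeSide (d := d + 1) M₀ L m) → ℝ) :
    Tendsto (fun k : ℕ => kingFreeS (d := d + 1) L M₀ a msq m k φ) atTop
      (𝓝 ((1 / 2 : ℝ) * (φ ⬝ᵥ ((Matrix.of fun b b' => effLaplacianLim L (cubeSide (d := d + 1) M₀ L m) a (unitMassSq msq L m) b b') *ᵥ φ))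
        + Real.log (gaussNorm (Matrix.of fun b b' => effLaplacianLim L (cubeSide (d := d + 1) M₀ L m) a (unitMassSq msq L m) b b')))) := by
  have hL1 : (1 : ℝ) < L := by exact_mod_cast (show 1 < L by omega)
  have hm2 : 0 < unitMassSq msq L m := unitMassSq_pos L hmsq (by omega) m
  have hN : 0 < gaussNorm (Matrix.of fun b b' => effLaplacianLim L (cubeSide (d := d + 1) M₀ L m) a (unitMassSq msq L m) b b') :=
    gaussNorm_pos (by have := aInf_pos ha hL1; positivity) (coercive_effLaplacianLim L _ hLodd hL ha hm2)
  -- the shifted sequence `k + 1` is the rung's sequence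
  rw [← tendsto_add_atTop_iff_nat 1]
  have hq := (tendsto_quadForm_effLaplacian L (cubeSide (d := d + 1) M₀ L m) hLodd hL ha hm2 φ).comp (tendsto_add_atTop_nat 1)
  have hg := ((tendsto_gaussNorm_effLaplacian L (cubeSide (d := d + 1) M₀ L m) hLodd hL ha hm2).comp (tendsto_add_atTop_nat 1)).log hN.ne'
  have h := (hq.const_mul (1 / 2 : ℝ)).add hg
  refine h.congr fun k => ?_
  simp only [Function.comp_apply, kingFreeS, kingFreeOp_succ]

/-- ★★★ **BY NAME ON THE `RGData` DATUM**: the field `S` of King's free-field renormalization-group datum `kingFreeRG` converges pointwise at every depth,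
`(kingFreeRG L M₀ a m² b₀ p).S m k φ → S^{(∞),1}(φ)` — the Cauchy sequence of Thm 3.4's proof (p. 657) has its limit identified in closed form.
[cite: King1986, Thm 3.4 (3.9) p.656, p.657, (3.14) p.657] -/
theorem tendsto_kingFreeRG_S (hLodd : Odd L) (hL : 2 ≤ L) {a msq : ℝ} (ha : 0 < a) (hmsq : 0 < msq) (b₀ p : ℝ) (m : ℕ)
    (φ : Tor (cubeSide (d := d + 1) M₀ L m) → ℝ) :
    Tendsto (fun k : ℕ => (kingFreeRG (d := d + 1) L M₀ a msq b₀ p).S m k φ) atTop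
      (𝓝 ((1 / 2 : ℝ) * (φ ⬝ᵥ ((Matrix.of fun b b' => effLaplacianLim L (cubeSide (d := d + 1) M₀ L m) a (unitMassSq msq L m) b b') *ᵥ φ))
        + Real.log (gaussNorm (Matrix.of fun b b' => effLaplacianLim L (cubeSide (d := d + 1) M₀ L m) a (unitMassSq msq L m) b b')))) :=
  tendsto_kingFreeS L M₀ hLodd hL ha hmsq m φ

/-! ## §2 The limit action is normalised; the densities converge -/

/-- ★★ **`∫ e^{−S^{(∞),1}(φ)} dφ = 1`**: the continuum action is normalised like every `S^{(k),1}` (`Z ≡ 1` for the free field). [cite: King1986, (2.6) p.652, (3.89)–(3.90) pp.668–669, Thm 2.1 (2.22) p.654] -/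
theorem integral_exp_neg_kingFreeS_lim (hLodd : Odd L) (hL : 2 ≤ L) {a msq : ℝ} (ha : 0 < a) (hmsq : 0 < msq) (m : ℕ) :
    ∫ φ : Tor (cubeSide (d := d + 1) M₀ L m) → ℝ,
        Real.exp (-((1 / 2 : ℝ) * (φ ⬝ᵥ ((Matrix.of fun b b' => effLaplacianLim L (cubeSide (d := d + 1) M₀ L m) a (unitMassSq msq L m) b b') *ᵥ φ))
          + Real.log (gaussNorm (Matrix.of fun b b' => effLaplacianLim L (cubeSide (d := d + 1) M₀ L m) a (unitMassSq msq L m) b b')))) = 1 := by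
  have hL1 : (1 : ℝ) < L := by exact_mod_cast (show 1 < L by omega)
  have hm2 : 0 < unitMassSq msq L m := unitMassSq_pos L hmsq (by omega) m
  have hN : 0 < gaussNorm (Matrix.of fun b b' => effLaplacianLim L (cubeSide (d := d + 1) M₀ L m) a (unitMassSq msq L m) b b') :=
    gaussNorm_pos (by have := aInf_pos ha hL1; positivity) (coercive_effLaplacianLim L _ hLodd hL ha hm2)
  have h := integral_gaussDensity_lim L (cubeSide (d := d + 1) M₀ L m) hLodd hL ha hm2
  refine Eq.trans (integral_congr_ae (Eventually.of_forall fun φ => ?_)) h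
  show Real.exp _ = Real.exp _ / _
  rw [neg_add, Real.exp_add, Real.exp_neg (Real.log _), Real.exp_log hN, div_eq_mul_inv]
  congr 1
  rw [neg_mul]

/-- ★ The densities converge pointwise: `e^{−S^{(k),1}(φ)} → e^{−S^{(∞),1}(φ)}`. [cite: King1986, Thm 3.4 (3.9) p.656, (3.10)–(3.11) p.656] -/
theorem tendsto_exp_neg_kingFreeS (hLodd : Odd L) (hL : 2 ≤ L) {a msq : ℝ} (ha : 0 < a) (hmsq : 0 < msq) (m : ℕ) (φ : Tor (cubeSide (d := d + 1) M₀ L m) → ℝ) :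
    Tendsto (fun k : ℕ => Real.exp (-(kingFreeS (d := d + 1) L M₀ a msq m k φ))) atTop
      (𝓝 (Real.exp (-((1 / 2 : ℝ) * (φ ⬝ᵥ ((Matrix.of fun b b' => effLaplacianLim L (cubeSide (d := d + 1) M₀ L m) a (unitMassSq msq L m) b b') *ᵥ φ))
        + Real.log (gaussNorm (Matrix.of fun b b' => effLaplacianLim L (cubeSide (d := d + 1) M₀ L m) a (unitMassSq msq L m) b b')))))) :=
  (Real.continuous_exp.tendsto _).comp (tendsto_kingFreeS L M₀ hLodd hL ha hmsq m φ).neg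

end Action

end Summit.QuantumFields.YangMills.BalabanUVNodes.N15KingModelRung

end
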